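import Mathlib
import Summits.ValiantsHypothesis.ValiantsHypothesis.Theorems.GrenetZeonTwoDimCoefficientsDefs
import Literature.Computability.AlgebraicComplexity.MignonRessayreBound
import Literature.Computability.AlgebraicComplexity.StandardFamiliesProofs

/-!
# Crux `GrenetZeon.TwoDimCoefficients` (stmt-ValiantsHypothesis-8062), line `dim2_cases` —
# the SQUARE INSTANCE of the unit case (calibration of the hypothesis `UnitDichotomy`)

Companion to the crux workfile `Cruxes/TwoDimCoefficients/UNIT-CASE-NOTE.md` (val-width-8062-p2).  The
line card treats the "unit case" (`det A` zero-free on `Z(per_n)`) as harmless.  It is not: the difference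
of squares

  `per_n = (1/4K)·(per_n + K)² − (1/4K)·(per_n − K)²`   (`K ≠ 0`)

is a SPLIT representation (`splitRepr_of_sq_pair`) in which both determinants are zero-free on `Z(per_n)`
(`eval_sq_shift_ne_zero`) and EVERY zero of either determinant is a point where its Hessian has rank `≤ 1`
(`rank_hess0_transl_sq_le_one`) — so the Mignon–Ressayre Hessian test, the only engine of the line, is void
there.  Consequently the registered hypothesis `UnitDichotomy` (stub 2 of the line) asserts, verbatim, the
quadratic lower bound `n² ≤ 2m + 2` for EVERY affine `m × m` matrix whose determinant is `c·(per_n + K)²`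
(`unitDichotomy_sq_shift_bound`); with the landed `stub_splitCase` (Theorems file
`GrenetZeonTwoDimCoefficientsStubSplitCase.lean`, one `exact` away, not imported here to keep this file off the
route cone) `HessianRankCodimTwo ∧ UnitDichotomy` gives `n² ≤ 8m` for the square pair: a
determinantal-complexity lower bound for the SQUARE of the shifted permanent of Mignon–Ressayre strength, for
which no method is on record (VBP factor closure transfers only a polynomial loss).  These are CALIBRATION
theorems: they make kernel-visible what the line's hypotheses entail; they prove no lower bound.  This file is
route-independent (imports only the line's `…Defs` and Literature).

HONEST FRAMING: nothing here bears on `VP ≠ VNP`; the content is that crux 8062 as typed contains the open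
question `dc((per_n + K)²) ≥ n²/C`.

References: T. Mignon, N. Ressayre, Int. Math. Res. Not. 2004:79, Thm. 1.1 (the Hessian test);
A. Sinhababu, T. Thierauf, *Factorization of polynomials given by arithmetic branching programs*, CCC 2020
(factor closure of VBP with polynomial loss).
-/

-- single-conjunct layout `Summits/ValiantsHypothesis/ValiantsHypothesis`: the duplicated namespace
-- component is mandated by the tree.
set_option linter.dupNamespace false

noncomputable section

namespace Summit.ValiantsHypothesis.ValiantsHypothesis.Cruxes.TwoDimCoefficients.DimTwoCases

open MvPolynomial Matrix
open Literature.Computability.AlgebraicComplexity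

namespace SquareInstance

variable {n : ℕ}

/-- The generic permanent is not a constant (`n ≥ 1`; `deg per_n = n`). [folklore] -/
theorem perPoly_ne_C (hn : 1 ≤ n) (c : ℂ) : perPoly (Fin n) ℂ ≠ C c := by
  intro h
  have hdeg : (perPoly (Fin n) ℂ).totalDegree = n := by
    rw [(totalDegree_perPoly_holds (n := Fin n) (k := ℂ) : (perPoly (Fin n) ℂ).totalDegree = _),
      Fintype.card_fin]
  rw [h, totalDegree_C] at hdeg
  omega

/-- Difference of squares: `per_n = (1/4K)(per_n + K)² − (1/4K)(per_n − K)²` for `K ≠ 0`. [folklore] -/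
theorem perPoly_eq_sq_sub_sq {K : ℂ} (hK : K ≠ 0) :
    perPoly (Fin n) ℂ = C (4 * K)⁻¹ * (perPoly (Fin n) ℂ + C K) ^ 2 +
      C (-(4 * K)⁻¹) * (perPoly (Fin n) ℂ - C K) ^ 2 := by
  have h4 : C (4 * K)⁻¹ * (C K * 4) = (1 : MvPolynomial (Fin n × Fin n) ℂ) := by
    rw [show (4 : MvPolynomial (Fin n × Fin n) ℂ) = C 4 from by rw [map_ofNat], ← map_mul, ← map_mul,
      ← C_1]
    congr 1
    field_simp
  rw [map_neg]
  linear_combination (-perPoly (Fin n) ℂ) * h4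

/-- **The square pair is a SPLIT representation.**  Affine `m × m` matrices with determinants
`(per_n + K)²` and `(per_n − K)²` (`K ≠ 0`) give `SplitRepr n m` with `α = 1/4K`, `β = −1/4K`. [folklore] -/
theorem splitRepr_of_sq_pair {m : ℕ} {K : ℂ} (hK : K ≠ 0) {A B : AffMat n m}
    (hA : IsAffine A) (hB : IsAffine B)
    (hdA : A.det = (perPoly (Fin n) ℂ + C K) ^ 2) (hdB : B.det = (perPoly (Fin n) ℂ - C K) ^ 2) :
    SplitRepr n m :=
  ⟨(4 * K)⁻¹, -(4 * K)⁻¹, A, B, hA, hB, by rw [hdA, hdB]; exact perPoly_eq_sq_sub_sq hK⟩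

/-- `c·(per_n + K)²` takes the value `c·K² ≠ 0` at every zero of `per_n`: it is zero-free on the permanental
hypersurface. [folklore] -/
theorem eval_sq_shift_ne_zero {c K : ℂ} (hc : c ≠ 0) (hK : K ≠ 0) (p : Fin n × Fin n → ℂ)
    (hp : eval p (perPoly (Fin n) ℂ) = 0) :
    eval p (C c * (perPoly (Fin n) ℂ + C K) ^ 2) ≠ 0 := by
  rw [map_mul, map_pow, map_add, eval_C, eval_C, hp, zero_add]
  exact mul_ne_zero hc (pow_ne_zero 2 hK)

/-- `c·(per_n + K)²` is not a constant (`n ≥ 1`, `c ≠ 0`). [folklore] -/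
theorem sq_shift_ne_C (hn : 1 ≤ n) {c K : ℂ} (hc : c ≠ 0) (c' : ℂ) :
    C c * (perPoly (Fin n) ℂ + C K) ^ 2 ≠ C c' := by
  intro h
  have hP : perPoly (Fin n) ℂ + C K ≠ 0 := by
    intro h0
    exact perPoly_ne_C hn (-K) (by rw [map_neg]; exact eq_neg_of_add_eq_zero_left h0)
  have hdeg := congrArg totalDegree h
  rw [totalDegree_mul_of_isDomain (by rwa [Ne, C_eq_zero]) (pow_ne_zero 2 hP), pow_two,
    totalDegree_mul_of_isDomain hP hP, totalDegree_C, totalDegree_C, zero_add] at hdeg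
  have h0 : (perPoly (Fin n) ℂ + C K).totalDegree = 0 := by omega
  rw [totalDegree_eq_zero_iff_eq_C] at h0
  refine perPoly_ne_C hn (coeff 0 (perPoly (Fin n) ℂ + C K) - K) ?_
  rw [map_sub]
  exact eq_sub_of_add_eq h0

/-- **The Hessian test is void for squares.**  At every zero `p` of `f` the Hessian of `c·f²` at `p` is
`2c·∇f(p)∇f(p)ᵀ`, of rank `≤ 1` (so `rank_hess0_det_le` carries no information at the zeros of an affine
determinant equal to `c·(per_n + K)²`). [folklore] -/
theorem rank_hess0_transl_sq_le_one {σ : Type*} [Fintype σ] (c : ℂ) (f : MvPolynomial σ ℂ)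
    (p : σ → ℂ) (hp : eval p f = 0) : (hess0 (transl p (C c * f ^ 2))).rank ≤ 1 := by
  have hcc : constantCoeff (transl p f) = 0 := by rw [constantCoeff_transl, hp]
  rw [map_mul, transl_C, hess0_C_mul, map_pow, pow_two, hess0_mul, hcc, zero_smul, zero_add,
    zero_add, ← two_smul ℂ, smul_smul]
  exact (rank_smul_le _ _).trans (rank_vecMulVec_le _ _)

end SquareInstance

open SquareInstance in
/-- **Calibration of `UnitDichotomy` (stub 2 of the line, verbatim): it asserts a Mignon–Ressayre-strength
lower bound for the SQUARE of the shifted permanent.**  If `UnitDichotomy` holds then every affine `m × m`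
matrix with determinant `c·(per_n + K)²` (`c, K ≠ 0`, `n ≥ 3`) has `n² ≤ 2m + 2` — although every zero of
that determinant is a rank-`≤ 1` point of its Hessian (`rank_hess0_transl_sq_le_one`). [folklore] -/
theorem unitDichotomy_sq_shift_bound (hU : UnitDichotomy) {n : ℕ} (hn : 3 ≤ n) {m : ℕ} {c K : ℂ}
    (hc : c ≠ 0) (hK : K ≠ 0) (A : AffMat n m) (hA : IsAffine A)
    (hdA : A.det = C c * (perPoly (Fin n) ℂ + C K) ^ 2) : n ^ 2 ≤ 2 * m + 2 := by
  rcases hU n hn m A hA (fun p hp => by rw [hdA]; exact eval_sq_shift_ne_zero hc hK p hp) with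
    ⟨c', hc'⟩ | h
  · exact absurd (hdA.symm.trans hc') (sq_shift_ne_C (by omega) hc c')
  · exact h

end Summit.ValiantsHypothesis.ValiantsHypothesis.Cruxes.TwoDimCoefficients.DimTwoCases

end
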